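import Summits.HodgeConjecture.HodgeConjecture.Theorems.NikulinTwinTransportLefschetzOneOneK3ChernCharacter
import Literature.AlgebraicGeometry.HodgeTheory.CartierDivisorChernClass
import Literature.Geometry.Kaehler.ChernCharacterCocycleIso
import Literature.AlgebraicGeometry.HodgeTheory.GAGALineBundles

/-!
# Route NikulinTwinTransport — `LefschetzOneOneK3` closed modulo GAGA for line bundles (Serre 1956)

Helper file (`--supports stmt-HodgeConjecture-13678`). After `NikulinTwinTransportLefschetzOneOneK3ChernCharacter`
(unconditional analytic Lefschetz `(1,1)`: a rational `(1,1)`-class is `a • c₁(L)` for ONE holomorphic line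
cocycle `L`) and `Literature/AlgebraicGeometry/HodgeTheory/CartierDivisorChernClass` (`c₁(𝒪_X(D)^an)` is an
algebraic class for EVERY Cartier divisor `D`), the route item `LefschetzOneOneK3` — and the named fact
`lefschetzOneOne_rational` in all dimensions — follow from ONE classical input, GAGA for line bundles:
every holomorphic line cocycle on `X^an` is holomorphically isomorphic to `𝒪_X(D)^an` for a Cartier divisor
`D` (Serre, GAGA (1956), n° 20 Prop. 18: `H¹(X, GL₁(𝒪)) → H¹(X^h, GL₁(𝒪^h))` is bijective for `X`
projective; with `Pic X = CaCl X` for `X` integral, Görtz–Wedhorn I Prop. 11.21). It is stated here as the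
named fact `serreGAGA_lineCocycle_iso_cartierDivisorCocycle` in the tree's cocycle vocabulary
(`SmoothComplexVectorBundle.CocycleIso`, `IsHolomorphic`, `cartierDivisorCocycle`), and:

* `chernCharacter_mem_algebraicClasses_of_serreGAGA` — granted GAGA, `c₁(V)` is algebraic for every
  holomorphic rank-one cocycle `V` (Chern character is an isomorphism invariant,
  `CocycleIso.chernCharacterDeRham_eq` with Chern–Weil II `mk_eq_mk_of_isChernCharacterForm_holds`);
* `lefschetzOneOneK3_of_serreGAGA : serreGAGA_… → LefschetzOneOneK3`;
* `lefschetzOneOne_rational_of_serreGAGA : serreGAGA_… → lefschetzOneOne_rational`.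

So the trust base of the item and of the named fact `lefschetzOneOne_rational` is exactly {GAGA for line
bundles}; everything else (Čech integrality, the Chern–Weil heart, rigidity, Chow, universal coefficients,
Chern–Weil I–II, `c₁(𝒪(D)) ` supported on `Supp D`) is proved in the tree.
-/

noncomputable section

namespace Summit.HodgeConjecture.HodgeConjecture.Theorems

open scoped Manifold ContDiff
open Literature.Geometry.Kaehler
open Literature.AlgebraicGeometry
open Literature.AlgebraicGeometry.HodgeTheory

variable {n : ℕ} {X : Motives.SchemeOver ℂ}

/-- **Granted GAGA for line bundles, the first Chern class of every holomorphic line cocycle on `X^an` is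
an algebraic class**: `c₁(V) = c₁(𝒪_X(D)^an)` for the divisor `D` of the fact (the Chern character is an
invariant of smoothly isomorphic cocycles, `CocycleIso.chernCharacterDeRham_eq`, Chern–Weil II being
`mk_eq_mk_of_isChernCharacterForm_holds`; holomorphic isomorphisms are smooth), and `c₁(𝒪_X(D)^an)` is
algebraic (`chernCharacter_cartierDivisorCocycle_mem_algebraicClasses'`, Voisin I Thm. 11.33).
[cite: SerreGAGA1956, n° 20 Prop. 18] [cite: VoisinHodgeI2002, Thm. 11.33] -/
theorem chernCharacter_mem_algebraicClasses_of_serreGAGA (hG : Literature.AlgebraicGeometry.HodgeTheory.serreGAGA_lineCocycle_iso_cartierDivisorCocycle)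
    (hX : Motives.IsSmoothProjective n X) (A : HodgeModel n X) {ι : Type}
    (V : SmoothComplexVectorBundle ι A.model A.carrier 1) (hV : V.IsHolomorphic) :
    A.chernCharacter V 1 ∈ algebraicClasses X 1 := by
  letI : AlgebraicGeometry.IsIntegral X.left := Motives.IsSmoothProjective.isIntegral_holds hX
  obtain ⟨D, Φ, hΦ⟩ := hG hX A ι V hV
  have heq : A.chernCharacter V 1 = A.chernCharacter (cartierDivisorCocycle A.isAnalytification D) 1 :=
    A.pullback_injective (2 * 1) (by
      rw [A.pullback_chernCharacter_eq, A.pullback_chernCharacter_eq,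
        SmoothComplexVectorBundle.CocycleIso.chernCharacterDeRham_eq
          (SmoothComplexVectorBundle.mk_eq_mk_of_isChernCharacterForm_holds A.model A.carrier) Φ hΦ.isSmooth 1])
  rw [heq]
  exact chernCharacter_cartierDivisorCocycle_mem_algebraicClasses' A D

/-- **`LefschetzOneOneK3` from GAGA for line bundles alone** (`lefschetzOneOneK3_of_chernClass_lineBundle_algebraic`
fed with `chernCharacter_mem_algebraicClasses_of_serreGAGA`). [cite: VoisinHodgeI2002, Thm. 11.30, Thm. 11.33 and §11.3.2]
[cite: SerreGAGA1956, n° 20 Prop. 18] -/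
theorem lefschetzOneOneK3_of_serreGAGA (hG : Literature.AlgebraicGeometry.HodgeTheory.serreGAGA_lineCocycle_iso_cartierDivisorCocycle) :
    Summit.HodgeConjecture.HodgeConjecture.Theses.NikulinTwinTransport.LefschetzOneOneK3 :=
  lefschetzOneOneK3_of_chernClass_lineBundle_algebraic fun _ hS A _ L ↦
    chernCharacter_mem_algebraicClasses_of_serreGAGA hG hS.1 A L.toSmoothCocycle L.toSmoothCocycle_isHolomorphic

/-- **The named fact `lefschetzOneOne_rational` (Lefschetz `(1,1)`, all dimensions) from GAGA for line
bundles alone**: a rational `(1,1)`-class is `a • c₁(L)` (`exists_eq_smul_chernCharacter_lineBundle`,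
unconditional) and `c₁(L)` is algebraic granted GAGA. [cite: VoisinHodgeI2002, Thm. 11.30, Cor. 11.34 and §11.3.2]
[cite: SerreGAGA1956, n° 20 Prop. 18] -/
theorem lefschetzOneOne_rational_of_serreGAGA (hG : Literature.AlgebraicGeometry.HodgeTheory.serreGAGA_lineCocycle_iso_cartierDivisorCocycle) :
    lefschetzOneOne_rational := by
  intro n X hX c hc h11
  obtain ⟨A, hA⟩ := h11
  obtain ⟨ι, L, a, rfl⟩ := exists_eq_smul_chernCharacter_lineBundle hX A c hc hA
  exact Submodule.smul_mem _ _
    (chernCharacter_mem_algebraicClasses_of_serreGAGA hG hX A L.toSmoothCocycle L.toSmoothCocycle_isHolomorphic)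

end Summit.HodgeConjecture.HodgeConjecture.Theorems

end
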